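import Literature.MathematicalPhysics.QuantumFieldTheory.Balaban1983to89.Step
import Literature.MathematicalPhysics.QuantumFieldTheory.Balaban1983to89.T4Covariance
import Literature.MathematicalPhysics.QuantumFieldTheory.Balaban1983to89.B12SmallFieldDomain259
import Literature.MathematicalPhysics.QuantumFieldTheory.Balaban1983to89.B12ChiInvariance269

/-!
# `Balaban1983to89.B12EuclClause263` — [Balaban1987RG1] p. 263, the Euclidean-invariance clause of the inductive
assumptions: «We assume that the action (1.3) is invariant with respect to the transformations of the lattice T⁽ᵏ⁾.
More precisely, we notice that the explicitly defined expressions in the j-th term in (1.3) are invariant with respect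
to the Euclidean transformations of the lattice T⁽ʲ⁺¹⁾, and we assume that this is true for all expressions in this
term.» — PACKAGED on the cell's tower `Step.SFTower` with the NESTED symmetry group (interface row I-r09-2), and the
implication «clause ⇒ first sentence» PROVED

HONEST FRAMING (cell `lit-balaban`, verbatim): statement-level skeleton of published theorems with citation tags;
proofs where landed; nothing here is a claim about the Yang–Mills mass gap.

CITATION HEADER.  T. Bałaban, *Renormalization group approach to lattice gauge field theories. I. Generation of
effective actions in a small field approximation and a coupling constant renormalization in four dimensions*,
Commun. Math. Phys. **109** (1987) 249–301, doi:10.1007/bf01215223 [Balaban1987RG1] (cell paper B12; held text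
`paper:balaban1987-cmp109-rg-i-small-field`, journal page = PDF page + 248; p. 263 [PDF 15] and p. 269 [PDF 21]
re-read for this module).  Unit `lit-balaban-r09` gen 10 (reader/typer of CMP 109, display owner), SKELETON rows
`B12.Txt@263b` (the clause), `B12.Eq2.17-2.18` ((2.17) «a Euclidean symmetry r of the torus T, preserving the torus
T⁽ᵏ⁺¹⁾»), `B12.Eq1.3` (the form (1.3)); interface row I-r09-2 of `HOME/INTERFACES.md` («remaining gap = packaging
translations + permutations + creflect as the (2.17) group acting on the `Step.SFTower` terms for the p. 263 clause»).

WHAT IS PRINTED (verbatim).  p. 263 [PDF 15]: *«Other symmetries are Euclidean lattice transformations. We assume that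
the action (1.3) is invariant with respect to the transformations of the lattice T⁽ᵏ⁾. More precisely, we notice that
the explicitly defined expressions in the j-th term in (1.3) are invariant with respect to the Euclidean
transformations of the lattice T⁽ʲ⁺¹⁾, and we assume that this is true for all expressions in this term.»*  p. 269
[PDF 21]: *«Now consider a Euclidean symmetry r of the torus T, preserving the torus T⁽ᵏ⁺¹⁾. We define generally
(rU)(b) = U(rb), rb = r⟨b₋, b₊⟩ = ⟨rb₋, rb₊⟩. (2.17)»*  (1.3) p. 260 [PDF 12] is the tree's `Step.SFTower.action13`:
`A_k(U_k) = −(1/g_k²)A(U_k) + Σ_{j=0}^{k−1} {−β_{j+1}(g_j)A(U_k) + [log Z⁽ʲ⁾(U_k) − log Z⁽ʲ⁾(1)] + [𝐄⁽ʲ⁺¹⁾(g_j,U_k) −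
𝐄⁽ʲ⁺¹⁾(g_j,1)]}` as a function of the background field `U_k` on the finest lattice `T_η` (`Site P 0`).

DICTIONARY print → Lean (the cell's centred block geometry (0.1)/(0.3), `Setup.emb`/`blockOf`).  «Euclidean
transformations of the lattice T⁽ʲ⁾», acting on configurations on `T_η ⊃ T⁽ʲ⁾` by the pull-back (2.17), ↦ the group
generated by (i) the translations of `T_η` by the fine vectors `L^j·a`, `a ∈ T⁽ʲ⁾` (`Site.scaleTo j a`,
`GaugeField.translate`; these are exactly the translations mapping `T⁽ʲ⁾ ⊂ T_η` onto itself, `Site.emb_add`), (ii) the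
CENTRE reflections `x_ρ ↦ −x_ρ − 1` of the labels (`GaugeField.creflect` of `T4Covariance`: they preserve every
`T⁽ʲ⁾ ⊂ T_η`, `Site.emb_creflect`; the naive axis reflection `x_ρ ↦ −x_ρ` does NOT, `AveragingReflection.not_reflect_equivariant`),
(iii) the coordinate permutations (`GaugeField.permute`).  Invariance of a function under the generators
(`NestedInvariant j`) is invariance under the group.  «the j-th term in (1.3)» ↦ `term13 T j`; «the explicitly defined
expressions» ↦ the Wilson-action summands `−β_{j+1}(g_j)A(U_k)` (and `−(1/g_k²)A(U_k)`); «all expressions in this term»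
↦ `U ↦ log Z⁽ʲ⁾(U)` and `U ↦ Re 𝐄⁽ʲ⁺¹⁾(g_j, U)` of the tower (`T.logZ j`, `T.Etot (j+1) (g j) (T.ofBackground ·)`).

WHAT IS PROVED (kernel-checked, no `sorry`, standard axioms; definitions with bodies `NestedInvariant`, `EuclInvariantC`,
`BackgroundCovariant`, `term13`, `EuclClause263`; no `Prop`-valued named fact):
* § 1 `NestedInvariant j F` and its calculus: `nestedInvariant_zero_iff` (at `j = 0`: all translations), **`mono`/`of_le`**
  (a coarser lattice is preserved by FEWER symmetries: `scaleTo (j+1) a = scaleTo j (L·a)`), `add`/`sub`/`neg`/`mul`/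
  `const_mul`/`const`/`comp`/`re`;
* § 2 «the explicitly defined expressions … are invariant»: **`wilsonAction4_nestedInvariant`** (every `j`; from the tree's
  `wilsonAction4_translate/_reflect/_permute` and `creflect = reflect ∘ translate`), `wilsonAction_nestedInvariant`;
* § 3 the tower: `term13`, **`action13_eq_sum_term13`** ((1.3) = leading term + Σ terms, `rfl` up to `Finset.sum`),
  `EuclClause263 T k` (= the assumption: for `j < k` the two non-explicit expressions of the `j`-th term are invariant
  under the transformations of `T⁽ʲ⁺¹⁾`), `term13_nestedInvariant`, and **`action13_nestedInvariant`**: the clause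
  IMPLIES the first sentence «the action (1.3) is invariant with respect to the transformations of the lattice T⁽ᵏ⁾»
  (read on `T_η`: invariance under the symmetries preserving `T⁽ᵏ⁾`; each `j`-th term is invariant under the larger
  group preserving `T⁽ʲ⁺¹⁾ ⊇`-wise, `j + 1 ≤ k`); `action16_nestedInvariant`, `Ek_nestedInvariant` likewise;
* § 4 one level: `EuclInvariantC` (translations + centre reflections + permutations of ONE torus `T⁽ᵏ⁾`) and
  **`euclInvariantC_iff_euclInvariant`** — on a single torus it is the gen-1 notion `B12SmallFieldDomain259.EuclInvariant`
  (naive reflections), because `c_ρ = r_ρ ∘ τ_{−e_ρ}` (`GaugeField.creflect_eq`, `creflect_translate_shift`);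
  `nestedInvariant_zero_iff_euclInvariantC`;
* § 5 across levels: `BackgroundCovariant k bgU` (a map `V ↦ U_k(V)` from `T⁽ᵏ⁾`- to `T_η`-configurations intertwining
  the symmetries of `T⁽ᵏ⁾` with those of `T_η` preserving `T⁽ᵏ⁾`) and **`euclInvariantC_comp_of_nestedInvariant`**:
  for such a map, `V ↦ A_k(U_k(V))` is Euclidean invariant on `T⁽ᵏ⁾` as soon as `A_k` is `NestedInvariant k` — the
  first sentence in its `V`-form «A_k(V) = A_k(U_k(V))» (p. 260); conversely **`nestedInvariant_comp_iter`**: a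
  one-level-invariant function of the averages `M^k(U)` is `NestedInvariant k` in `U` when every averaging step is
  covariant (`AveragingRT.iter_translate/iter_creflect/iter_permute` of `T4Covariance`/`T4Continuum`), e.g. the tree's
  axial average (`axial_nestedCovariant`: `axial_avg_translate`, `axial_avg_creflect` — permutations need the
  hypothesis, the axial average being direction-labelled).
NOT CLAIMED: that Bałaban's minimizers `U_k(V)` ARE `BackgroundCovariant` (covariance of the variational problem [15]
is not in the tree; it enters as the hypothesis), nor the clause itself for the genuine `log Z⁽ʲ⁾`, `𝐄⁽ʲ⁾` (it is an
inductive ASSUMPTION in print, discharged in [I] §2/(2.17)–(2.18) and [II]; the cell's `Step.SFHyp` leaves it untyped,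
DIVERGENCE D-f2.1 — this module supplies the missing field as the separate `Prop` `EuclClause263`, importer-safe).

v1.1 (unit `lit-balaban-r09` gen 10, 2026-08-21; APPEND-ONLY new § 6, no v1.0 declaration changed): the permutation
clause of `axial_nestedCovariant` DISCHARGED — `lineSite_permute`/`line_permute` (the straight contour of a permuted
coarse bond is the permuted contour), `pathProd_permute`, **`axialAvg_permute`** (`axialAvg (U ∘ π) = (axialAvg U) ∘ π`),
`axial_avg_permute`, hence **`axial_nestedCovariant'`** (hypothesis-free: the tree's axial averaging family is
nested-covariant) and `nestedInvariant_comp_axialIter` (every one-level Euclidean-invariant function of the axial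
averages `M^k(U)` is invariant under the transformations of `T_η` preserving `T⁽ᵏ⁾`).

v1.2 (unit `lit-balaban-r09` gen 10, 2026-08-21; APPEND-ONLY new § 7 + one import `B12ChiInvariance269` for the bond
map `cbond`; no v1.1 declaration changed): THE BACKGROUND MAP.  v1.0's `BackgroundCovariant` (strict covariance
`U_k(rV) = r·U_k(V)`) is replaced, for the tree's `Setup.Background` DATA, by what the papers give: [B11]
= [Balaban1985Variational] Thm 1 p. 279 makes the minimal ORBIT unique («modulo gauge»), so the minimal configuration
of a transformed datum is the transformed minimal configuration UP TO A GAUGE TRANSFORMATION, and the first sentence of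
p. 263 for `A_k(V) = A_k(U_k(V))` (p. 260) follows from the GAUGE invariance of `A_k` together with its invariance under
the transformations of `T_η` preserving `T⁽ᵏ⁾`.  PROVED: `creflect_apply_cbond`, `creflect_creflect` (the centre
reflection of configurations is an involution), `IsBackground.transport` (constrained minimality is transported by a
pair of mutually inverse symmetries intertwining the averages and preserving the regular class and the Wilson action),
its three instances `IsBackground.translate` / `.creflect` / `.permute` (nested-covariant averagings, e.g. the axial
ones by `axial_nestedCovariant'`), the predicate `UniqueModGauge` ([B11] Thm 1 as a hypothesis on the data, on a domain
`D`), and **`action_comp_background_invariant`**: uniqueness modulo gauge on an invariant domain + invariant regular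
class + gauge-invariant, nested-invariant `A_k` ⇒ `V ↦ A_k(U_k(V))` is invariant under the translations, centre
reflections and permutations of `T⁽ᵏ⁾` on that domain (`euclInvariantC_comp_background` when the domain is everything).

v1.3 (unit `lit-balaban-r09` gen 10, 2026-08-21; DOCFIX ONLY — no declaration, statement or proof changed): the docstring
of `IsBackground.transport` no longer calls the transport «the mechanism of [B11] (181) p. 307» — p. 307 prints (181)
`U_k(V^v) = U_k(V)^{v̄}` as a gauge-covariance identity extended by analyticity, not a transport-of-minimality argument;
the lemma is our elementary analogue for lattice symmetries and is now cited to the p. 263 clause it serves (referee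
ref-1 g33 F4-minor, 2026-08-21T17:12:43Z).

v1.4 (unit `lit-balaban-r09` gen 48, 2026-08-24; APPEND-ONLY new § 8, no import added, no earlier declaration changed):
THE PERMUTATION CLAUSE FOR THE PRINTED `χ_k` OF (2.9).  `B12ChiInvariance269` § 5–§ 6 proved «all the remaining
operations preserve the invariance» (p. 269, after (2.18)) for the printed characteristic function under the coarse
translations and the centre reflections; the third generator of the symmetries «preserving the torus T⁽ᵏ⁺¹⁾» — the
coordinate permutations `π` — is served here (this file imports `B12ChiInvariance269`, not conversely, and holds § 6's
`line_permute`): `permute_b0` (`π b₀(c) = b₀(π c)`), `exists_b0_eq_permute_iff` (the excluded set `{b₀(c)}` of (2.9) is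
permutation stable), **`chiFluctPrinted_permute`** / `chiFluct_permute` (`χ_k(B′ ∘ π) = χ_k(B′)`, with any bondwise
isometries), so that `χ_k` is `NestedInvariant`-shaped under all three generators together with
`B12ChiInvariance269.chiFluctPrinted_translate` / `chiFluctPrinted_cbond`.
-/

namespace Literature.MathematicalPhysics.QuantumFieldTheory.Balaban1983to89.B12EuclClause263

open Literature.MathematicalPhysics.QuantumFieldTheory.Balaban1983to89

/-! ## 1. Invariance under the Euclidean transformations of `T_η` preserving `T⁽ʲ⁾` -/

section Nested

variable {P : Params} {G : Type*} [GaugeGroup G] {α : Type*}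

/-- **«invariant with respect to the Euclidean transformations of the lattice T⁽ʲ⁾»** for a function of the
configurations on the finest torus `T_η` (on which `T⁽ʲ⁾` sits as the centres of the `j`-blocks): invariance under the
pull-backs (2.17) along (i) the translations by `L^j·a`, `a ∈ T⁽ʲ⁾`, (ii) the centre reflections, (iii) the coordinate
permutations — a generating set of the symmetries of `T_η` preserving `T⁽ʲ⁾`. [cite: Balaban1987RG1, §1 p.263] -/
def NestedInvariant (j : ℕ) (F : GaugeField P 0 G → α) : Prop :=
  (∀ (a : Site P j) (U : GaugeField P 0 G), F (U.translate (Site.scaleTo j a)) = F U) ∧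
  (∀ (ρ : Fin P.d) (U : GaugeField P 0 G), F (U.creflect ρ) = F U) ∧
  (∀ (π : Equiv.Perm (Fin P.d)) (U : GaugeField P 0 G), F (U.permute π) = F U)

/-- At `j = 0` (the lattice `T_η` itself) the translations are ALL translations of `T_η`. [cite: Balaban1987RG1, §1 p.263] -/
theorem nestedInvariant_zero_iff (F : GaugeField P 0 G → α) :
    NestedInvariant 0 F ↔
      (∀ (a : Site P 0) (U : GaugeField P 0 G), F (U.translate a) = F U) ∧
      (∀ (ρ : Fin P.d) (U : GaugeField P 0 G), F (U.creflect ρ) = F U) ∧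
      (∀ (π : Equiv.Perm (Fin P.d)) (U : GaugeField P 0 G), F (U.permute π) = F U) := Iff.rfl

namespace NestedInvariant

variable {j : ℕ} {F F₁ F₂ : GaugeField P 0 G → α}

/-- **Monotonicity**: the symmetries preserving the coarser lattice `T⁽ʲ⁺¹⁾` are among those preserving `T⁽ʲ⁾`
(`L^{j+1}·a = L^j·(L·a)`, `Site.scaleTo_succ`), so invariance for `T⁽ʲ⁾` implies invariance for `T⁽ʲ⁺¹⁾`.
[cite: Balaban1987RG1, §1 p.263] -/
theorem mono (h : NestedInvariant j F) : NestedInvariant (j+1) F :=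
  ⟨fun a U => by rw [Site.scaleTo_succ]; exact h.1 (Site.scale a) U, h.2.1, h.2.2⟩

/-- Monotonicity along `j ≤ j'`. [cite: Balaban1987RG1, §1 p.263] -/
theorem of_le {j' : ℕ} (h : NestedInvariant j F) (hjj' : j ≤ j') : NestedInvariant j' F := by
  induction hjj' with
  | refl => exact h
  | step _ ih => exact ih.mono

/-- Sums of invariant functions are invariant. [cite: Balaban1987RG1, §1 p.263] -/
theorem add [Add α] (h₁ : NestedInvariant j F₁) (h₂ : NestedInvariant j F₂) :
    NestedInvariant j (fun U => F₁ U + F₂ U) :=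
  ⟨fun a U => by dsimp only; rw [h₁.1, h₂.1], fun ρ U => by dsimp only; rw [h₁.2.1, h₂.2.1],
   fun π U => by dsimp only; rw [h₁.2.2, h₂.2.2]⟩

/-- Differences of invariant functions are invariant. [cite: Balaban1987RG1, §1 p.263] -/
theorem sub [Sub α] (h₁ : NestedInvariant j F₁) (h₂ : NestedInvariant j F₂) :
    NestedInvariant j (fun U => F₁ U - F₂ U) :=
  ⟨fun a U => by dsimp only; rw [h₁.1, h₂.1], fun ρ U => by dsimp only; rw [h₁.2.1, h₂.2.1],
   fun π U => by dsimp only; rw [h₁.2.2, h₂.2.2]⟩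

/-- Products of invariant functions are invariant. [cite: Balaban1987RG1, §1 p.263] -/
theorem mul [Mul α] (h₁ : NestedInvariant j F₁) (h₂ : NestedInvariant j F₂) :
    NestedInvariant j (fun U => F₁ U * F₂ U) :=
  ⟨fun a U => by dsimp only; rw [h₁.1, h₂.1], fun ρ U => by dsimp only; rw [h₁.2.1, h₂.2.1],
   fun π U => by dsimp only; rw [h₁.2.2, h₂.2.2]⟩

/-- Negatives of invariant functions are invariant. [cite: Balaban1987RG1, §1 p.263] -/
theorem neg [Neg α] (h : NestedInvariant j F) : NestedInvariant j (fun U => -F U) :=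
  ⟨fun a U => by dsimp only; rw [h.1], fun ρ U => by dsimp only; rw [h.2.1], fun π U => by dsimp only; rw [h.2.2]⟩

/-- Scalar multiples (e.g. `−β_{j+1}(g_j)·A(U)`, `−(1/g_k²)·A(U)`). [cite: Balaban1987RG1, §1 p.263] -/
theorem const_mul [Mul α] (h : NestedInvariant j F) (c : α) : NestedInvariant j (fun U => c * F U) :=
  ⟨fun a U => by dsimp only; rw [h.1], fun ρ U => by dsimp only; rw [h.2.1], fun π U => by dsimp only; rw [h.2.2]⟩

/-- Constants (e.g. the vacuum subtractions `log Z⁽ʲ⁾(1)`, `𝐄⁽ʲ⁺¹⁾(g_j, 1)`). [cite: Balaban1987RG1, §1 p.263] -/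
theorem const (j : ℕ) (c : α) : NestedInvariant (P := P) (G := G) j (fun _ => c) :=
  ⟨fun _ _ => rfl, fun _ _ => rfl, fun _ _ => rfl⟩

/-- Post-composition with any map (e.g. `Re`, `exp`). [cite: Balaban1987RG1, §1 p.263] -/
theorem comp {β : Type*} (h : NestedInvariant j F) (g : α → β) : NestedInvariant j (fun U => g (F U)) :=
  ⟨fun a U => by dsimp only; rw [h.1], fun ρ U => by dsimp only; rw [h.2.1], fun π U => by dsimp only; rw [h.2.2]⟩

/-- Finite sums of invariant functions. [cite: Balaban1987RG1, §1 p.263] -/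
theorem sum [AddCommMonoid α] {ι : Type*} (s : Finset ι) {Fi : ι → GaugeField P 0 G → α}
    (h : ∀ i ∈ s, NestedInvariant j (Fi i)) : NestedInvariant j (fun U => ∑ i ∈ s, Fi i U) :=
  ⟨fun a U => Finset.sum_congr rfl fun i hi => (h i hi).1 a U,
   fun ρ U => Finset.sum_congr rfl fun i hi => (h i hi).2.1 ρ U,
   fun π U => Finset.sum_congr rfl fun i hi => (h i hi).2.2 π U⟩

end NestedInvariant

end Nested

/-! ## 2. «the explicitly defined expressions … are invariant»: the Wilson action -/

section Wilson

variable {P : Params} {G : Type*} [GaugeGroup G]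

/-- The centre reflection is a symmetry of the Wilson action of ONE torus (it is the axis reflection of a translate:
`GaugeField.creflect_eq`). [cite: Balaban1987RG1, §1 p.263] -/
theorem wilsonAction_creflect {k : ℕ} (w : ℝ) (ρ : Fin P.d) (U : GaugeField P k G) :
    wilsonAction w (U.creflect ρ) = wilsonAction w U := by
  rw [GaugeField.creflect_eq, GaugeField.wilsonAction_reflect, GaugeField.wilsonAction_translate]

/-- **The explicit term `A(U_k)` (0.2) is invariant under the transformations of `T_η` preserving ANY `T⁽ʲ⁾`** (indeed
under all translations, centre reflections and permutations of `T_η`). [cite: Balaban1987RG1, §1 p.263] -/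
theorem wilsonAction_nestedInvariant (w : ℝ) (j : ℕ) :
    NestedInvariant j (wilsonAction (P := P) (j := 0) (G := G) w) :=
  ⟨fun a U => GaugeField.wilsonAction_translate w (Site.scaleTo j a) U, fun ρ U => wilsonAction_creflect w ρ U,
   fun π U => GaugeField.wilsonAction_permute w π U⟩

/-- The `d = 4` Wilson action `wilsonAction4` (the `A` of (1.3)) is nested-invariant at every level.
[cite: Balaban1987RG1, §1 p.263] -/
theorem wilsonAction4_nestedInvariant (j : ℕ) :
    NestedInvariant j (wilsonAction4 (P := P) (j := 0) (G := G)) :=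
  wilsonAction_nestedInvariant 1 j

end Wilson

/-! ## 3. The clause on the tower `Step.SFTower` and «clause ⇒ the action (1.3) is invariant» -/

section Tower

variable {P : Params} {G : Type*} [GaugeGroup G] {Φ 𝒢 : Type*}

/-- **The `j`-th term of (1.3)** (p. 260): `−β_{j+1}(g_j)A(U) + [log Z⁽ʲ⁾(U) − log Z⁽ʲ⁾(1)] + [Re 𝐄⁽ʲ⁺¹⁾(g_j, U) −
Re 𝐄⁽ʲ⁺¹⁾(g_j, 1)]` — the summand of `Step.SFTower.action13`. [cite: Balaban1987RG1, (1.3) p.260] -/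
noncomputable def term13 (T : Step.SFTower P G Φ 𝒢) (j : ℕ) (U : GaugeField P 0 G) : ℝ :=
  -(T.flow.β (j+1) (T.flow.g j)) * wilsonAction4 U
    + (T.logZ j U - T.logZ j 1)
    + ((T.Etot (j+1) (T.flow.g j) (T.ofBackground U)).re - (T.Etot (j+1) (T.flow.g j) (T.ofBackground 1)).re)

/-- (1.3) = leading term + the sum of its `j`-th terms, `j < k` (definitional). [cite: Balaban1987RG1, (1.3) p.260] -/
theorem action13_eq_sum_term13 (T : Step.SFTower P G Φ 𝒢) (k : ℕ) (U : GaugeField P 0 G) :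
    T.action13 k U = -(1 / (T.flow.g k) ^ 2) * wilsonAction4 U + ∑ j ∈ Finset.range k, term13 T j U := rfl

/-- **THE CLAUSE of p. 263** as a property of a tower, for the `k`-th action: for every `j < k`, the NON-explicit
expressions of the `j`-th term of (1.3) — `U ↦ log Z⁽ʲ⁾(U)` and `U ↦ Re 𝐄⁽ʲ⁺¹⁾(g_j, U)` — are invariant with respect to
the Euclidean transformations of `T_η` preserving `T⁽ʲ⁺¹⁾` («we assume that this is true for all expressions in this
term»; the explicit expression `−β_{j+1}(g_j)A(U)` IS invariant, § 2).  This is the field the cell's `Step.SFHyp` leaves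
untyped (DIVERGENCE D-f2.1), supplied importer-safely as a separate `Prop`. [cite: Balaban1987RG1, §1 p.263] -/
def EuclClause263 (T : Step.SFTower P G Φ 𝒢) (k : ℕ) : Prop :=
  ∀ j < k, NestedInvariant (j+1) (T.logZ j) ∧
    NestedInvariant (j+1) (fun U : GaugeField P 0 G => (T.Etot (j+1) (T.flow.g j) (T.ofBackground U)).re)

/-- Under the clause, the whole `j`-th term is invariant under the transformations preserving `T⁽ʲ⁺¹⁾`.
[cite: Balaban1987RG1, §1 p.263] -/
theorem term13_nestedInvariant (T : Step.SFTower P G Φ 𝒢) {k j : ℕ} (h : EuclClause263 T k) (hj : j < k) :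
    NestedInvariant (j+1) (term13 T j) := by
  obtain ⟨hZ, hE⟩ := h j hj
  unfold term13
  exact (((wilsonAction4_nestedInvariant (j+1)).const_mul _).add
    (hZ.sub (NestedInvariant.const (j+1) _))).add (hE.sub (NestedInvariant.const (j+1) _))

/-- **«We assume that the action (1.3) is invariant with respect to the transformations of the lattice T⁽ᵏ⁾. More
precisely …»** — the implication PROVED: if every `j`-th term (`j < k`) satisfies the clause, then `A_k` in the form
(1.3) is invariant under the Euclidean transformations of `T_η` preserving `T⁽ᵏ⁾` (each `j`-th term is invariant under
the LARGER group preserving `T⁽ʲ⁺¹⁾`, `j + 1 ≤ k`, `NestedInvariant.of_le`; the leading term by § 2).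
[cite: Balaban1987RG1, §1 p.263] -/
theorem action13_nestedInvariant (T : Step.SFTower P G Φ 𝒢) {k : ℕ} (h : EuclClause263 T k) :
    NestedInvariant k (T.action13 k) := by
  have hsum : NestedInvariant k (fun U : GaugeField P 0 G => ∑ j ∈ Finset.range k, term13 T j U) :=
    NestedInvariant.sum _ fun j hj =>
      (term13_nestedInvariant T h (Finset.mem_range.mp hj)).of_le (Finset.mem_range.mp hj)
  have h0 := ((wilsonAction4_nestedInvariant (P := P) (G := G) k).const_mul (-(1 / (T.flow.g k) ^ 2))).add hsum
  refine ⟨fun a U => ?_, fun ρ U => ?_, fun π U => ?_⟩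
  · rw [action13_eq_sum_term13, action13_eq_sum_term13]; exact h0.1 a U
  · rw [action13_eq_sum_term13, action13_eq_sum_term13]; exact h0.2.1 ρ U
  · rw [action13_eq_sum_term13, action13_eq_sum_term13]; exact h0.2.2 π U

/-- The clause restricted to the `𝐄`-expressions gives the invariance of `𝐄_k` (0.23) = `Step.SFTower.Ek`.
[cite: Balaban1987RG1, (0.23) p.256] -/
theorem Ek_nestedInvariant (T : Step.SFTower P G Φ 𝒢) {k : ℕ}
    (h : ∀ j < k, NestedInvariant (j+1) (fun U : GaugeField P 0 G => (T.Etot (j+1) (T.flow.g j) (T.ofBackground U)).re)) :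
    NestedInvariant k (T.Ek k) := by
  unfold Step.SFTower.Ek
  exact NestedInvariant.sum _ fun j hj =>
    ((((wilsonAction4_nestedInvariant (j+1)).const_mul _).add
      ((h j (Finset.mem_range.mp hj)).sub (NestedInvariant.const (j+1) _))).of_le (Finset.mem_range.mp hj))

/-- The same for the form (1.6) = `Step.SFTower.action16`. [cite: Balaban1987RG1, (1.6) p.261] -/
theorem action16_nestedInvariant (T : Step.SFTower P G Φ 𝒢) {k : ℕ}
    (h : ∀ j < k, NestedInvariant (j+1) (fun U : GaugeField P 0 G => (T.Etot (j+1) (T.flow.g j) (T.ofBackground U)).re)) :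
    NestedInvariant k (T.action16 k) := by
  have h0 := ((wilsonAction4_nestedInvariant (P := P) (G := G) k).const_mul (-(1 / (T.flow.g k) ^ 2))).add
    (Ek_nestedInvariant T h)
  refine ⟨fun a U => ?_, fun ρ U => ?_, fun π U => ?_⟩
  · rw [Step.SFTower.action16_eq, Step.SFTower.action16_eq]; exact h0.1 a U
  · rw [Step.SFTower.action16_eq, Step.SFTower.action16_eq]; exact h0.2.1 ρ U
  · rw [Step.SFTower.action16_eq, Step.SFTower.action16_eq]; exact h0.2.2 π U

/-- The clause for `k` implies the clause for every `k' ≤ k` (fewer terms). [cite: Balaban1987RG1, §1 p.263] -/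
theorem EuclClause263.of_le {T : Step.SFTower P G Φ 𝒢} {k k' : ℕ} (h : EuclClause263 T k) (hk : k' ≤ k) :
    EuclClause263 T k' :=
  fun j hj => h j (lt_of_lt_of_le hj hk)

end Tower

/-! ## 4. One torus: translations + CENTRE reflections + permutations = the gen-1 notion `EuclInvariant` -/

section OneLevel

variable {P : Params} {k : ℕ} {G : Type*} [GaugeGroup G]

/-- Euclidean invariance of a function of the configurations on ONE torus `T⁽ᵏ⁾`, with the CENTRE reflections as the
reflection generators (the block-compatible choice; cf. `B12SmallFieldDomain259.EuclInvariant`, which uses the naive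
axis reflections — equivalent on one level, `euclInvariantC_iff_euclInvariant`). [cite: Balaban1987RG1, (2.17) p.269] -/
def EuclInvariantC (F : GaugeField P k G → ℝ) : Prop :=
  (∀ (a : Site P k) (U : GaugeField P k G), F (U.translate a) = F U) ∧
  (∀ (ρ : Fin P.d) (U : GaugeField P k G), F (U.creflect ρ) = F U) ∧
  (∀ (π : Equiv.Perm (Fin P.d)) (U : GaugeField P k G), F (U.permute π) = F U)

/-- **On a single torus the two reflection conventions give the same invariance notion** (given the translations):
`c_ρ = r_ρ ∘ τ_{−e_ρ}` (`GaugeField.creflect_eq`) and `r_ρ = c_ρ ∘ τ_{e_ρ}` (`GaugeField.creflect_translate_shift`).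
[cite: Balaban1987RG1, (2.17) p.269] -/
theorem euclInvariantC_iff_euclInvariant (F : GaugeField P k G → ℝ) :
    EuclInvariantC F ↔ B12SmallFieldDomain259.EuclInvariant F := by
  constructor
  · rintro ⟨ht, hc, hp⟩
    refine ⟨ht, hp, fun μ U => ?_⟩
    rw [← GaugeField.creflect_translate_shift, hc, ht]
  · rintro ⟨ht, hp, hr⟩
    refine ⟨ht, fun ρ U => ?_, hp⟩
    rw [GaugeField.creflect_eq, hr, ht]

/-- At level `0`, `NestedInvariant 0` is `EuclInvariantC` on `T_η`. [cite: Balaban1987RG1, §1 p.263] -/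
theorem nestedInvariant_zero_iff_euclInvariantC (F : GaugeField P 0 G → ℝ) :
    NestedInvariant 0 F ↔ EuclInvariantC F := Iff.rfl

/-- Hence at level `0` it is also the gen-1 notion. [cite: Balaban1987RG1, §1 p.263] -/
theorem nestedInvariant_zero_iff_euclInvariant (F : GaugeField P 0 G → ℝ) :
    NestedInvariant 0 F ↔ B12SmallFieldDomain259.EuclInvariant F :=
  (nestedInvariant_zero_iff_euclInvariantC F).trans (euclInvariantC_iff_euclInvariant F)

end OneLevel

/-! ## 5. Across levels: `A_k(V) = A_k(U_k(V))` and functions of the averages `M^k(U)` -/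

section Across

variable {P : Params} {k : ℕ} {G : Type*} [GaugeGroup G]

/-- A map `V ↦ U_k(V)` from configurations on `T⁽ᵏ⁾` to configurations on `T_η` is EUCLIDEAN COVARIANT when it
intertwines the symmetries of `T⁽ᵏ⁾` with the symmetries of `T_η` preserving `T⁽ᵏ⁾`: `U_k(τ_a V) = τ_{L^k a}U_k(V)`,
`U_k(c_ρ V) = c_ρ U_k(V)`, `U_k(π V) = π U_k(V)` (the shape in which the covariance of the minimizers of [15] enters;
NOT proved here for them). [cite: Balaban1987RG1, (2.17) p.269] -/
def BackgroundCovariant (k : ℕ) (bgU : GaugeField P k G → GaugeField P 0 G) : Prop :=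
  (∀ (a : Site P k) (V : GaugeField P k G), bgU (V.translate a) = (bgU V).translate (Site.scaleTo k a)) ∧
  (∀ (ρ : Fin P.d) (V : GaugeField P k G), bgU (V.creflect ρ) = (bgU V).creflect ρ) ∧
  (∀ (π : Equiv.Perm (Fin P.d)) (V : GaugeField P k G), bgU (V.permute π) = (bgU V).permute π)

/-- **The first sentence in its `V`-form** («The k-th action A_k(V) depends on V through the minimal configuration
U_k(V), A_k(V) = A_k(U_k(V))», p. 260; «invariant with respect to the transformations of the lattice T⁽ᵏ⁾», p. 263):
for a Euclidean-covariant background map, `V ↦ A_k(U_k(V))` is Euclidean invariant on `T⁽ᵏ⁾` whenever `A_k` is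
invariant under the transformations of `T_η` preserving `T⁽ᵏ⁾`. [cite: Balaban1987RG1, §1 p.263] -/
theorem euclInvariantC_comp_of_nestedInvariant {bgU : GaugeField P k G → GaugeField P 0 G}
    (hbg : BackgroundCovariant k bgU) {Ak : GaugeField P 0 G → ℝ} (hA : NestedInvariant k Ak) :
    EuclInvariantC (fun V => Ak (bgU V)) :=
  ⟨fun a V => by dsimp only; rw [hbg.1, hA.1], fun ρ V => by dsimp only; rw [hbg.2.1, hA.2.1],
   fun π V => by dsimp only; rw [hbg.2.2, hA.2.2]⟩

/-- In particular for the tower's (1.3): clause + covariant background ⇒ `V ↦ A_k(U_k(V))` Euclidean invariant on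
`T⁽ᵏ⁾` (both reflection conventions, § 4). [cite: Balaban1987RG1, §1 p.263] -/
theorem action13_comp_euclInvariant {Φ 𝒢 : Type*} (T : Step.SFTower P G Φ 𝒢)
    (h : EuclClause263 T k) {bgU : GaugeField P k G → GaugeField P 0 G} (hbg : BackgroundCovariant k bgU) :
    B12SmallFieldDomain259.EuclInvariant (fun V => T.action13 k (bgU V)) :=
  (euclInvariantC_iff_euclInvariant _).mp
    (euclInvariantC_comp_of_nestedInvariant hbg (action13_nestedInvariant T h))

/-- A family of one-step averagings is NESTED-COVARIANT when each step intertwines the coarse symmetries with the fine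
ones (translations by `L·a`, centre reflections, permutations) — the hypothesis shape of
`AveragingRT.iter_translate`/`iter_creflect`/`iter_permute`. [cite: Balaban1987RG1, (2.17) p.269] -/
def AveragingNestedCovariant (av : ∀ j, Averaging P j G) : Prop :=
  (∀ (j : ℕ) (a : Site P (j+1)) (U : GaugeField P j G),
      (av j).avg (U.translate (Site.scale a)) = ((av j).avg U).translate a) ∧
  (∀ (j : ℕ) (ρ : Fin P.d) (U : GaugeField P j G), (av j).avg (U.creflect ρ) = ((av j).avg U).creflect ρ) ∧
  (∀ (j : ℕ) (π : Equiv.Perm (Fin P.d)) (U : GaugeField P j G), (av j).avg (U.permute π) = ((av j).avg U).permute π)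

/-- **Functions of the averages**: if `F` on `T⁽ᵏ⁾`-configurations is Euclidean invariant (one level, centre
reflections) and the averagings are nested-covariant, then `U ↦ F(M^k(U))` on `T_η` is invariant under the
transformations preserving `T⁽ᵏ⁾` — by `AveragingRT.iter_translate`, `iter_creflect`, `iter_permute`.
[cite: Balaban1987RG1, (2.17) p.269] -/
theorem nestedInvariant_comp_iter {av : ∀ j, Averaging P j G} (hav : AveragingNestedCovariant av) (k : ℕ)
    {F : GaugeField P k G → ℝ} (hF : EuclInvariantC F) :
    NestedInvariant k (fun U : GaugeField P 0 G => F (Averaging.iter av k U)) :=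
  ⟨fun a U => by dsimp only; rw [T4Continuum.iter_translate av hav.1 k a U, hF.1],
   fun ρ U => by dsimp only; rw [T4Continuum.iter_creflect av ρ (hav.2.1 · ρ) k U, hF.2.1],
   fun π U => by dsimp only; rw [T4Continuum.iter_permute av π (hav.2.2 · π) k U, hF.2.2]⟩

/-- The tree's AXIAL (decimation) averaging `AveragingRT.axial` is nested-covariant for translations and centre
reflections (`AveragingRT.axial_avg_translate`, `axial_avg_creflect` of `T4Covariance`); for permutations the
covariance is taken as a hypothesis (the axial average transports along the bond's own axis, so it holds — but the
tree lemma is not available in this cone). [cite: Balaban1987RG1, (2.17) p.269] -/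
theorem axial_nestedCovariant
    (hperm : ∀ (j : ℕ) (π : Equiv.Perm (Fin P.d)) (U : GaugeField P j G),
      (AveragingRT.axial : Averaging P j G).avg (U.permute π) = ((AveragingRT.axial : Averaging P j G).avg U).permute π) :
    AveragingNestedCovariant (fun j => (AveragingRT.axial : Averaging P j G)) :=
  ⟨fun _ a U => AveragingRT.axial_avg_translate U a, fun _ ρ U => AveragingRT.axial_avg_creflect ρ U, hperm⟩

end Across

/-! ## 6. (v1.1) The axial averaging is nested-covariant: the permutation clause discharged -/

section AxialPermute

variable {P : Params} {j : ℕ}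

/-- The straight contour of a permuted coarse bond is the permuted contour, site by site
(`emb (y ∘ π⁻¹) = (emb y) ∘ π⁻¹` coordinatewise). [cite: Balaban1987RG1, (2.17) p.269] -/
theorem lineSite_permute (π : Equiv.Perm (Fin P.d)) (c : PBond P (j+1)) (t : ℕ) :
    (AveragingRT.lineSite c t).permute π = AveragingRT.lineSite (c.permute π) t := by
  funext ν
  simp only [Site.permute_apply, AveragingRT.lineSite, PBond.permute]
  by_cases h : ν = π c.dir
  · subst h
    simp only [Equiv.symm_apply_apply, Function.update_self]
    show emb c.src c.dir + (t : ZMod (P.sitesPerDir j)) = emb (Site.permute π c.src) (π c.dir) + t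
    simp only [emb, Site.permute_apply, Equiv.symm_apply_apply]
  · have h' : π.symm ν ≠ c.dir := fun h'' => h (by rw [← h'', Equiv.apply_symm_apply])
    rw [Function.update_of_ne h', Function.update_of_ne h]
    rfl

/-- The same on bonds: `π(line c t) = line (π c) t`. [cite: Balaban1987RG1, (2.17) p.269] -/
theorem line_permute (π : Equiv.Perm (Fin P.d)) (c : PBond P (j+1)) (t : ℕ) :
    (AveragingRT.line c t).permute π = AveragingRT.line (c.permute π) t := by
  show (⟨(AveragingRT.lineSite c t).permute π, π c.dir⟩ : PBond P j) = ⟨AveragingRT.lineSite (c.permute π) t, π c.dir⟩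
  rw [lineSite_permute]

variable {G : Type*} [GaugeGroup G]

/-- Parallel transport along the line of `c` in the permuted configuration = transport along the line of `π c`.
[cite: Balaban1987RG1, (2.17) p.269] -/
theorem pathProd_permute (π : Equiv.Perm (Fin P.d)) (U : GaugeField P j G) (c : PBond P (j+1)) :
    ∀ n, AveragingRT.pathProd (U.permute π) c n = AveragingRT.pathProd U (c.permute π) n
  | 0 => rfl
  | n + 1 => by
    rw [AveragingRT.pathProd, AveragingRT.pathProd, pathProd_permute π U c n, GaugeField.permute_apply, line_permute]

/-- **The axial average commutes with the coordinate permutations**: `axialAvg (U ∘ π) = (axialAvg U) ∘ π` (the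
companion of `T4Covariance`'s `axialAvg_translate`, `axialAvg_creflect`). [cite: Balaban1987RG1, (2.17) p.269] -/
theorem axialAvg_permute (π : Equiv.Perm (Fin P.d)) (U : GaugeField P j G) :
    AveragingRT.axialAvg (U.permute π) = (AveragingRT.axialAvg U).permute π := by
  funext c
  exact pathProd_permute π U c P.L

/-- The same for the `Averaging` structure `AveragingRT.axial`. [cite: Balaban1987RG1, (2.17) p.269] -/
theorem axial_avg_permute (π : Equiv.Perm (Fin P.d)) (U : GaugeField P j G) :
    (AveragingRT.axial : Averaging P j G).avg (U.permute π) =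
      ((AveragingRT.axial : Averaging P j G).avg U).permute π := by
  simp only [AveragingRT.axial_avg]
  exact axialAvg_permute π U

/-- **The tree's axial averaging family is nested-covariant**, hypothesis-free (v1.0's `axial_nestedCovariant` with
its permutation clause discharged by `axial_avg_permute`). [cite: Balaban1987RG1, (2.17) p.269] -/
theorem axial_nestedCovariant' :
    AveragingNestedCovariant (fun j => (AveragingRT.axial : Averaging P j G)) :=
  axial_nestedCovariant fun _ π U => axial_avg_permute π U

/-- Hence every one-level Euclidean-invariant function of the `k`-fold axial averages `M^k(U)` is invariant under the
transformations of `T_η` preserving `T⁽ᵏ⁾`. [cite: Balaban1987RG1, §1 p.263] -/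
theorem nestedInvariant_comp_axialIter (k : ℕ) {F : GaugeField P k G → ℝ} (hF : EuclInvariantC F) :
    NestedInvariant k (fun U : GaugeField P 0 G =>
      F (Averaging.iter (fun j => (AveragingRT.axial : Averaging P j G)) k U)) :=
  nestedInvariant_comp_iter axial_nestedCovariant' k hF

end AxialPermute

/-! ## 7. (v1.2) The background map: covariance modulo gauge from the uniqueness of the minimal orbit ([B11] Thm 1),
hence the first sentence of p. 263 for `A_k(V) = A_k(U_k(V))` -/

section BackgroundMap

variable {P : Params} {j : ℕ} {G : Type*} [GaugeGroup G]

/-- The centre reflection of configurations evaluated through the bond map `cbond` of `B12ChiInvariance269`: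
`(c_ρU)(b) = U(c_ρ b)` for `b ∦ e_ρ`, `= U(c_ρ b)⁻¹` for `b ∥ e_ρ` (reflected `ρ`-bonds are traversed backwards).
[cite: Balaban1987RG1, (2.17) p.269] -/
theorem creflect_apply_cbond (ρ : Fin P.d) (U : GaugeField P j G) (b : PBond P j) :
    U.creflect ρ b = if b.dir = ρ then (U (B12ChiInvariance269.cbond ρ b))⁻¹ else U (B12ChiInvariance269.cbond ρ b) :=
  rfl

/-- **The centre reflection of configurations is an involution** (the same statement is proved summit-side as
`Summit.QuantumFields.BalabanUV.T4Continuum.HistoryRPHalfTorus.creflect_creflect`, which `Literature/` cannot import;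
re-proved here in three lines through `B12ChiInvariance269.cbond_cbond`). [cite: Balaban1987RG1, (2.17) p.269] -/
theorem creflect_creflect (ρ : Fin P.d) (U : GaugeField P j G) : (U.creflect ρ).creflect ρ = U := by
  funext b
  rw [creflect_apply_cbond]
  by_cases h : b.dir = ρ
  · have h' : (B12ChiInvariance269.cbond ρ b).dir = ρ := h
    rw [if_pos h, creflect_apply_cbond, if_pos h', B12ChiInvariance269.cbond_cbond, inv_inv]
  · have h' : (B12ChiInvariance269.cbond ρ b).dir ≠ ρ := h
    rw [if_neg h, creflect_apply_cbond, if_neg h', B12ChiInvariance269.cbond_cbond]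

omit [GaugeGroup G] in
/-- `τ_{-a} ∘ τ_a = id` on configurations. [cite: Balaban1987RG1, (2.17) p.269] -/
theorem translate_translate_neg (a : Site P j) (U : GaugeField P j G) : (U.translate a).translate (-a) = U := by
  rw [GaugeField.translate_translate, neg_add_cancel, GaugeField.translate_zero]

omit [GaugeGroup G] in
/-- `π⁻¹ ∘ π = id` on configurations. [cite: Balaban1987RG1, (2.17) p.269] -/
theorem permute_permute_symm (π : Equiv.Perm (Fin P.d)) (U : GaugeField P j G) :
    (U.permute π).permute π⁻¹ = U := by
  rw [GaugeField.permute_permute, mul_inv_cancel, GaugeField.permute_one]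

variable {av : ∀ j, Averaging P j G} {reg : Set (GaugeField P 0 G)} {k : ℕ}

/-- **Transport of constrained minimality** (cf. [B11] (181) p. 307 — there a GAUGE-covariance identity
`U_k(V^v) = U_k(V)^{v̄}` of the minimal configurations, extended by analyticity; here the analogous transport for the
LATTICE symmetries, our elementary argument; v1.3 wording, referee ref-1 g33): if `r₀` (on `T_η`-configurations, inverse
`s₀`) and `r` (on `T⁽ᵏ⁾`-configurations, injective) intertwine the `k`-fold averages, preserve the regular class and the
Wilson action, then `r₀` carries a minimiser over `{M^k(U) = V} ∩ reg` to one over `{M^k(U) = rV} ∩ reg`.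
[cite: Balaban1987RG1, §1 p.263] -/
theorem IsBackground.transport {r₀ s₀ : GaugeField P 0 G → GaugeField P 0 G}
    {r : GaugeField P k G → GaugeField P k G} (h₂ : ∀ U, r₀ (s₀ U) = U)
    (hiter : ∀ U, Averaging.iter av k (r₀ U) = r (Averaging.iter av k U)) (hr : Function.Injective r)
    (hreg₁ : ∀ U ∈ reg, r₀ U ∈ reg) (hreg₂ : ∀ U ∈ reg, s₀ U ∈ reg)
    (hS : ∀ U, wilsonAction4 (r₀ U) = wilsonAction4 U)
    {V : GaugeField P k G} {U₀ : GaugeField P 0 G} (h : IsBackground av reg k V U₀) :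
    IsBackground av reg k (r V) (r₀ U₀) := by
  refine ⟨by rw [hiter, h.1], hreg₁ _ h.2.1, fun U hU hMU => ?_⟩
  have hs : Averaging.iter av k (s₀ U) = V := hr (by rw [← hiter, h₂, hMU])
  calc wilsonAction4 (r₀ U₀) = wilsonAction4 U₀ := hS _
    _ ≤ wilsonAction4 (s₀ U) := h.2.2 _ (hreg₂ _ hU) hs
    _ = wilsonAction4 (r₀ (s₀ U)) := (hS _).symm
    _ = wilsonAction4 U := by rw [h₂]

/-- Translations: `U₀` minimal for `V` ⇒ `U₀ ∘ τ_{Lᵏa}` minimal for `V ∘ τ_a` (nested-covariant averagings, translation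
invariant regular class). [cite: Balaban1987RG1, §1 p.263] -/
theorem IsBackground.translate (hav : AveragingNestedCovariant av)
    (hreg : ∀ (a : Site P k) (U : GaugeField P 0 G), U ∈ reg → U.translate (Site.scaleTo k a) ∈ reg)
    {V : GaugeField P k G} {U₀ : GaugeField P 0 G} (h : IsBackground av reg k V U₀) (a : Site P k) :
    IsBackground av reg k (V.translate a) (U₀.translate (Site.scaleTo k a)) := by
  refine IsBackground.transport (r₀ := fun U => U.translate (Site.scaleTo k a))
    (s₀ := fun U => U.translate (Site.scaleTo k (-a))) (r := fun W => W.translate a) ?_ ?_ ?_ ?_ ?_ ?_ h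
  · intro U; rw [map_neg, GaugeField.translate_translate, add_neg_cancel, GaugeField.translate_zero]
  · intro U; exact T4Continuum.iter_translate av hav.1 k a U
  · intro W W' hW
    have := congrArg (fun X : GaugeField P k G => X.translate (-a)) hW
    simpa only [translate_translate_neg] using this
  · exact fun U hU => hreg a U hU
  · exact fun U hU => hreg (-a) U hU
  · exact fun U => (wilsonAction4_nestedInvariant k).1 a U

/-- Centre reflections: `U₀` minimal for `V` ⇒ `c_ρU₀` minimal for `c_ρV`. [cite: Balaban1987RG1, §1 p.263] -/
theorem IsBackground.creflect (hav : AveragingNestedCovariant av)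
    (hreg : ∀ (ρ : Fin P.d) (U : GaugeField P 0 G), U ∈ reg → U.creflect ρ ∈ reg)
    {V : GaugeField P k G} {U₀ : GaugeField P 0 G} (h : IsBackground av reg k V U₀) (ρ : Fin P.d) :
    IsBackground av reg k (V.creflect ρ) (U₀.creflect ρ) := by
  refine IsBackground.transport (r₀ := fun U => U.creflect ρ) (s₀ := fun U => U.creflect ρ)
    (r := fun W => W.creflect ρ) (fun U => creflect_creflect ρ U) ?_ ?_ (hreg ρ) (hreg ρ) ?_ h
  · intro U; exact T4Continuum.iter_creflect av ρ (hav.2.1 · ρ) k U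
  · intro W W' hW
    have := congrArg (fun X : GaugeField P k G => X.creflect ρ) hW
    simpa only [creflect_creflect] using this
  · exact fun U => (wilsonAction4_nestedInvariant k).2.1 ρ U

/-- Coordinate permutations: `U₀` minimal for `V` ⇒ `U₀ ∘ π` minimal for `V ∘ π`. [cite: Balaban1987RG1, §1 p.263] -/
theorem IsBackground.permute (hav : AveragingNestedCovariant av)
    (hreg : ∀ (π : Equiv.Perm (Fin P.d)) (U : GaugeField P 0 G), U ∈ reg → U.permute π ∈ reg)
    {V : GaugeField P k G} {U₀ : GaugeField P 0 G} (h : IsBackground av reg k V U₀) (π : Equiv.Perm (Fin P.d)) :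
    IsBackground av reg k (V.permute π) (U₀.permute π) := by
  refine IsBackground.transport (r₀ := fun U => U.permute π) (s₀ := fun U => U.permute π⁻¹)
    (r := fun W => W.permute π) ?_ ?_ ?_ (hreg π) (hreg π⁻¹) ?_ h
  · intro U; rw [GaugeField.permute_permute, inv_mul_cancel, GaugeField.permute_one]
  · intro U; exact T4Continuum.iter_permute av π (hav.2.2 · π) k U
  · intro W W' hW
    have := congrArg (fun X : GaugeField P k G => X.permute π⁻¹) hW
    simpa only [permute_permute_symm] using this
  · exact fun U => (wilsonAction4_nestedInvariant k).2.2 π U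

/-- **[B11] Thm 1 («the minimal orbit is unique») as a hypothesis on a background assignment `bgU` over a domain
`D`**: every regular constrained minimiser for `V ∈ D` is a gauge transform of the selected one `bgU V` (the tree's
`Setup.IsBackground` quotes Thm 1 as a leaf; nothing of [B11] is asserted here). [cite: Balaban1985Variational, Thm 1 p.279] -/
def UniqueModGauge (av : ∀ j, Averaging P j G) (reg : Set (GaugeField P 0 G)) (k : ℕ)
    (D : Set (GaugeField P k G)) (bgU : GaugeField P k G → GaugeField P 0 G) : Prop :=
  ∀ V ∈ D, ∀ U₁ : GaugeField P 0 G, IsBackground av reg k V U₁ →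
    ∃ u : GaugeTransf P 0 G, U₁ = GaugeField.gaugeAct u (bgU V)

/-- **THE FIRST SENTENCE OF p. 263 FOR `A_k(V) = A_k(U_k(V))` (p. 260), from the uniqueness of the minimal orbit**:
for the tree's background DATA `Setup.Background` on a domain invariant under the transformations of `T⁽ᵏ⁾`, with an
invariant regular class, nested-covariant averagings and the minimiser unique modulo gauge on the domain, every
GAUGE-INVARIANT `A_k` invariant under the transformations of `T_η` preserving `T⁽ᵏ⁾` gives a `V ↦ A_k(U_k(V))`
invariant under the translations, centre reflections and coordinate permutations of `T⁽ᵏ⁾`, at every `V` of the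
domain (the minimal configuration of the transformed `V` is the transformed minimal configuration up to gauge:
`IsBackground.translate`/`.creflect`/`.permute` + `UniqueModGauge`). [cite: Balaban1987RG1, §1 p.263] -/
theorem action_comp_background_invariant (bg : Background P G av) (k : ℕ)
    (hdomT : ∀ (a : Site P k) (V : GaugeField P k G), V ∈ bg.dom k → V.translate a ∈ bg.dom k)
    (hdomC : ∀ (ρ : Fin P.d) (V : GaugeField P k G), V ∈ bg.dom k → V.creflect ρ ∈ bg.dom k)
    (hdomP : ∀ (π : Equiv.Perm (Fin P.d)) (V : GaugeField P k G), V ∈ bg.dom k → V.permute π ∈ bg.dom k)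
    (hregT : ∀ (a : Site P k) (U : GaugeField P 0 G), U ∈ bg.reg → U.translate (Site.scaleTo k a) ∈ bg.reg)
    (hregC : ∀ (ρ : Fin P.d) (U : GaugeField P 0 G), U ∈ bg.reg → U.creflect ρ ∈ bg.reg)
    (hregP : ∀ (π : Equiv.Perm (Fin P.d)) (U : GaugeField P 0 G), U ∈ bg.reg → U.permute π ∈ bg.reg)
    (hav : AveragingNestedCovariant av) (huniq : UniqueModGauge av bg.reg k (bg.dom k) (bg.U k))
    {Ak : GaugeField P 0 G → ℝ} (hAg : GaugeField.GaugeInvariant Ak) (hAn : NestedInvariant k Ak)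
    {V : GaugeField P k G} (hV : V ∈ bg.dom k) :
    (∀ a : Site P k, Ak (bg.U k (V.translate a)) = Ak (bg.U k V)) ∧
    (∀ ρ : Fin P.d, Ak (bg.U k (V.creflect ρ)) = Ak (bg.U k V)) ∧
    (∀ π : Equiv.Perm (Fin P.d), Ak (bg.U k (V.permute π)) = Ak (bg.U k V)) := by
  have hbg := bg.isBackground k V hV
  refine ⟨fun a => ?_, fun ρ => ?_, fun π => ?_⟩
  · obtain ⟨u, hu⟩ := huniq _ (hdomT a V hV) ((bg.U k V).translate (Site.scaleTo k a))
      (IsBackground.translate hav hregT hbg a)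
    rw [← hAn.1 a (bg.U k V), hu, hAg]
  · obtain ⟨u, hu⟩ := huniq _ (hdomC ρ V hV) ((bg.U k V).creflect ρ) (IsBackground.creflect hav hregC hbg ρ)
    rw [← hAn.2.1 ρ (bg.U k V), hu, hAg]
  · obtain ⟨u, hu⟩ := huniq _ (hdomP π V hV) ((bg.U k V).permute π) (IsBackground.permute hav hregP hbg π)
    rw [← hAn.2.2 π (bg.U k V), hu, hAg]

/-- The same packaged as `EuclInvariantC` when the domain is everything (e.g. after restricting the datum type).
[cite: Balaban1987RG1, §1 p.263] -/
theorem euclInvariantC_comp_background (bg : Background P G av) (k : ℕ) (hdom : bg.dom k = Set.univ)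
    (hregT : ∀ (a : Site P k) (U : GaugeField P 0 G), U ∈ bg.reg → U.translate (Site.scaleTo k a) ∈ bg.reg)
    (hregC : ∀ (ρ : Fin P.d) (U : GaugeField P 0 G), U ∈ bg.reg → U.creflect ρ ∈ bg.reg)
    (hregP : ∀ (π : Equiv.Perm (Fin P.d)) (U : GaugeField P 0 G), U ∈ bg.reg → U.permute π ∈ bg.reg)
    (hav : AveragingNestedCovariant av) (huniq : UniqueModGauge av bg.reg k (bg.dom k) (bg.U k))
    {Ak : GaugeField P 0 G → ℝ} (hAg : GaugeField.GaugeInvariant Ak) (hAn : NestedInvariant k Ak) :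
    EuclInvariantC (fun V => Ak (bg.U k V)) := by
  have key := fun V => action_comp_background_invariant bg k
    (fun _ _ _ => by rw [hdom]; trivial) (fun _ _ _ => by rw [hdom]; trivial) (fun _ _ _ => by rw [hdom]; trivial)
    hregT hregC hregP hav huniq hAg hAn (V := V) (by rw [hdom]; trivial)
  exact ⟨fun a V => (key V).1 a, fun ρ V => (key V).2.1 ρ, fun π V => (key V).2.2 π⟩

end BackgroundMap

/-! ## 8. (v1.4) The printed `χ_k` of (2.9) under the coordinate permutations of (2.17) -/

section ChiPermute

variable {P : Params} {j k : ℕ}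

/-- **(2.17) for permutations, on the distinguished bonds**: `π b₀(c) = b₀(π c)` — the middle bond of the straight
contour of `c` goes to the middle bond of the straight contour of `π c` (§ 6 `line_permute`).
[cite: Balaban1987RG1, (2.17) p.269] -/
theorem permute_b0 (π : Equiv.Perm (Fin P.d)) (c : PBond P (k+1)) :
    (B12SmallFieldDomain259.b0 c).permute π = B12SmallFieldDomain259.b0 (c.permute π) :=
  line_permute π c _

/-- The coordinate permutations PRESERVE the excluded set `{b₀(c) : c ∈ T⁽ᵏ⁺¹⁾}` of (2.9).
[cite: Balaban1987RG1, (2.17) p.269][cite: Balaban1987RG1, (2.9) p.266] -/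
theorem exists_b0_eq_permute_iff (π : Equiv.Perm (Fin P.d)) (b : PBond P k) :
    (∃ c : PBond P (k+1), B12SmallFieldDomain259.b0 c = b.permute π) ↔
      ∃ c : PBond P (k+1), B12SmallFieldDomain259.b0 c = b := by
  constructor
  · rintro ⟨c, hc⟩
    refine ⟨c.permute π⁻¹, ?_⟩
    rw [← permute_b0, hc, PBond.permute_permute, inv_mul_cancel, PBond.permute_one]
  · rintro ⟨c, rfl⟩
    exact ⟨c.permute π, (permute_b0 π c).symm⟩

variable {𝔤 : Type*} [Norm 𝔤]

/-- **(2.17), coordinate permutations, for the printed `χ_k`** («all the remaining operations preserve the invariance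
for the same reasons as for the gauge invariance»): relabelling the bonds by `b ↦ π b` — for a permutation every `π b`
is positively oriented, so (2.18) adds no `R(·)` factor — composed with any bondwise isometries `Φ_b` leaves
`χ_k = Π_{b ∉ {b₀(c)}} χ({|B′(b)| < ε₁})` invariant (`B12ChiInvariance269.chiFluctPrinted_comp_local_isometry` with the
bijection `PBond.permuteEquiv π` and `exists_b0_eq_permute_iff`). [cite: Balaban1987RG1, (2.17) p.269]
[cite: Balaban1987RG1, (2.9) p.266] -/
theorem chiFluctPrinted_permute (ε₁ : ℝ) (π : Equiv.Perm (Fin P.d)) (Φ : PBond P k → 𝔤 → 𝔤)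
    (hΦ : ∀ b X, ‖Φ b X‖ = ‖X‖) (B : VecField P k 𝔤) :
    B12SmallFieldDomain259.chiFluctPrinted ε₁ (fun b => Φ b (B (b.permute π))) =
      B12SmallFieldDomain259.chiFluctPrinted ε₁ B :=
  B12ChiInvariance269.chiFluctPrinted_comp_local_isometry ε₁ (PBond.permuteEquiv π)
    (fun b => exists_b0_eq_permute_iff π b) Φ hΦ B

/-- The all-bonds cutoff of `B12SmallFieldDomain259` § 2 under the same permutations (no preservation needed).
[cite: Balaban1987RG1, (2.17) p.269] -/
theorem chiFluct_permute (ε₁ : ℝ) (π : Equiv.Perm (Fin P.d)) (Φ : PBond P k → 𝔤 → 𝔤) (hΦ : ∀ b X, ‖Φ b X‖ = ‖X‖)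
    (B : VecField P k 𝔤) :
    B12SmallFieldDomain259.chiFluct ε₁ (fun b => Φ b (B (b.permute π))) = B12SmallFieldDomain259.chiFluct ε₁ B :=
  B12ChiInvariance269.chiFluct_comp_local_isometry ε₁ (PBond.permuteEquiv π) Φ hΦ B

/-- **THE PRINTED `χ_k` IS INVARIANT UNDER ALL THREE GENERATORS of the symmetries «preserving the torus T⁽ᵏ⁺¹⁾»**
(coarse translations, centre reflections, coordinate permutations), acting on the fluctuation field by pull-back —
`B12ChiInvariance269.chiFluctPrinted_translate` / `chiFluctPrinted_cbond` and `chiFluctPrinted_permute` collected.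
[cite: Balaban1987RG1, (2.17) p.269][cite: Balaban1987RG1, (2.9) p.266] -/
theorem chiFluctPrinted_euclid (ε₁ : ℝ) (B : VecField P k 𝔤) :
    (∀ a : Site P (k+1), B12SmallFieldDomain259.chiFluctPrinted ε₁ (fun b => B (b.translate (Site.scale a)))
        = B12SmallFieldDomain259.chiFluctPrinted ε₁ B) ∧
    (∀ ρ : Fin P.d, B12SmallFieldDomain259.chiFluctPrinted ε₁ (fun b => B (B12ChiInvariance269.cbond ρ b))
        = B12SmallFieldDomain259.chiFluctPrinted ε₁ B) ∧
    (∀ π : Equiv.Perm (Fin P.d), B12SmallFieldDomain259.chiFluctPrinted ε₁ (fun b => B (b.permute π))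
        = B12SmallFieldDomain259.chiFluctPrinted ε₁ B) :=
  ⟨fun a => B12ChiInvariance269.chiFluctPrinted_translate ε₁ a (fun _ X => X) (fun _ _ => rfl) B,
   fun ρ => B12ChiInvariance269.chiFluctPrinted_cbond ε₁ ρ (fun _ X => X) (fun _ _ => rfl) B,
   fun π => chiFluctPrinted_permute ε₁ π (fun _ X => X) (fun _ _ => rfl) B⟩

end ChiPermute

end Literature.MathematicalPhysics.QuantumFieldTheory.Balaban1983to89.B12EuclClause263
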